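import Summits.Schanuel.Schanuel.Theorems.DiophantineDichotomyApproximationPropertyOrbitDichotomy
import Summits.Schanuel.Schanuel.Theorems.DiophantineDichotomyApproximationPropertyCycleAPIAt3SatelliteHeightConjugates
import Summits.Schanuel.Schanuel.Theorems.DiophantineDichotomyApproximationPropertyCycleAPIAt3SatelliteHeightCramer
import Literature.NumberTheory.Transcendental.PhilipponCriterionCut
import HarnessLib

/-!
# Stub plan `CycleAPIAt3`, P3′ lemmas (III): small forms through a Galois orbit (towards `stub_satelliteHeight`)

Crux `stmt-Schanuel-6117` (`Summit.Schanuel.Schanuel.Theses.DiophantineDichotomy.ApproximationProperty`),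
route `DiophantineDichotomy`, line `orbit-interpolation-determinant`, registered stub
`stub_satelliteHeight : SatelliteHeight` (vocabulary `…CycleAPIAt3Defs.lean`). This file PROVES
the arithmetic input of that stub, an ABSOLUTE Siegel lemma with basis for the ideal of a Galois
orbit (registered sub-goal `orbit_small_forms`):

**for every `m, ν ≥ 1` there is `C = C(m, ν)` such that for every homogeneous prime `𝔭` of
`ℚ[x₀, …, x_m]` of rank `1` (a Galois orbit of `D = deg 𝔭` points) the degree-`ν` part `𝔭_ν` is
spanned by forms `G` with `h(G) ≤ C (h(𝔭)/D + 1)`** — uniformly in `D`.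

Proof. By the 0-dimensional dictionary (`stub_zeroDimDictionary`) `V(𝔭)` is the orbit of
`b̄ ∈ K^{m+1}`, `[K:ℚ] = D`, `h_K(b̄) ≤ h(𝔭) + cD`, and `G ∈ 𝔭 ⟺ G(b̄) = 0` for forms `G`
(projective Nullstellensatz). So the coefficient vectors of `𝔭_ν` form the kernel `V ⊆ ℚ^ι`
(`ι` = monomials of degree `ν`, `#ι = N`) of `v ↦ ∑ v_k b̄^k ∈ K`. Take pivot coordinates `I₀` of
`V` and its reduced echelon basis `e_j`, `j ∉ I₀` (`SatelliteHeightConjugates.exists_echelon`). The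
monomial values `(b̄^k)_{k ∈ I₀}` are `ℚ`-independent (a relation would be a vector of `V`
supported in `I₀`), so their conjugate vectors are independent over the compositum `L ⊂ ℂ` of
the conjugate fields (`conj_linearIndependent`), and some `#I₀` conjugates `σ_a` give an
invertible block `(σ_a(b̄^k))_{a, k ∈ I₀}` (`SatelliteHeightCramer.exists_isUnit_submatrix`). For
`j ∉ I₀` the Cramer vector `w` of the rows `(σ_a(b̄^k))_k` with free column `j`
(`exists_cramer_vector`) and `e_j` both lie in the kernel of these rows and agree off `I₀` up to
the factor `w_j`; kernel vectors supported in `I₀` vanish (invertible block), so `w = w_j e_j` and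
`h(e_j) = h_L(w)/[L:ℚ] ≤ #I₀ (ν h_K(b̄)/D + log N) ≤ Nν (h(𝔭)/D + c) + N log N`
(Veronese rows have height `ν h(σ_a b̄)`, conjugates are equi-high:
`NguyenRoy.logHeight_comp_div_finrank`). No definitions.

Sources: BombieriVaaler1983 (Thm 9: Siegel lemma with basis over number fields) and
BombieriGubler2006 §2.9 for the shape of the statement; NesterenkoPhilippon2001 (LNM 1752) Ch. 3
§4–5 for the dictionary; the proof here is self-contained linear algebra.
-/

noncomputable section

-- `Summit.Schanuel.Schanuel.…` is the mandated summit/sub-problem namespace (single-conjunct summit), hence: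
set_option linter.dupNamespace false

namespace Summit.Schanuel.Schanuel.Cruxes.ApproximationProperty.OrbitInterpolationDeterminant

open Literature.NumberTheory.Transcendental Literature.NumberTheory.Transcendental.Nesterenko
open MvPolynomial
open scoped BigOperators

namespace SatelliteHeightOrbitForms

variable {m : ℕ} {ν : ℕ}

/-! ## Forms of degree `ν` as coefficient vectors indexed by the exponents of degree `ν` -/

/-- The exponent (as a finitely supported function) of an index of degree `ν`. [folklore] -/
theorem degree_expnt (k : ↥(Finset.Nat.antidiagonalTuple (m + 1) ν)) :
    (Finsupp.equivFunOnFinite.symm (k : Fin (m + 1) → ℕ)).degree = ν := by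
  rw [Finsupp.degree_eq_sum]
  simpa using Finset.Nat.mem_antidiagonalTuple.mp k.2

/-- Distinct indices have distinct exponents. [folklore] -/
theorem expnt_injective : Function.Injective
    (fun k : ↥(Finset.Nat.antidiagonalTuple (m + 1) ν) =>
      Finsupp.equivFunOnFinite.symm (k : Fin (m + 1) → ℕ)) :=
  fun _ _ h => Subtype.ext (Finsupp.equivFunOnFinite.symm.injective h)

/-- The coefficient of the `k`-th monomial of the form with coefficient vector `v`. [folklore] -/
theorem coeff_poly (v : ↥(Finset.Nat.antidiagonalTuple (m + 1) ν) → ℚ)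
    (k : ↥(Finset.Nat.antidiagonalTuple (m + 1) ν)) :
    coeff (Finsupp.equivFunOnFinite.symm (k : Fin (m + 1) → ℕ))
      (Fintype.linearCombination ℚ (fun k' : ↥(Finset.Nat.antidiagonalTuple (m + 1) ν) =>
        (monomial (Finsupp.equivFunOnFinite.symm (k' : Fin (m + 1) → ℕ)) (1 : ℚ) : Rx m)) v) = v k := by
  classical
  rw [Fintype.linearCombination_apply, coeff_sum]
  simp_rw [coeff_smul, coeff_monomial, smul_eq_mul, mul_ite, mul_one, mul_zero]
  simp_rw [expnt_injective.eq_iff]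
  rw [Finset.sum_ite_eq']
  simp

/-- Coefficients of the wrong degree vanish. [folklore] -/
theorem coeff_poly_of_ne (v : ↥(Finset.Nat.antidiagonalTuple (m + 1) ν) → ℚ)
    {d : Fin (m + 1) →₀ ℕ} (hd : d.degree ≠ ν) :
    coeff d (Fintype.linearCombination ℚ (fun k' : ↥(Finset.Nat.antidiagonalTuple (m + 1) ν) =>
        (monomial (Finsupp.equivFunOnFinite.symm (k' : Fin (m + 1) → ℕ)) (1 : ℚ) : Rx m)) v) = 0 := by
  classical
  rw [Fintype.linearCombination_apply, coeff_sum]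
  refine Finset.sum_eq_zero fun k _ => ?_
  rw [coeff_smul, coeff_monomial, if_neg, smul_zero]
  intro h
  exact hd (by rw [← h]; exact degree_expnt k)

/-- The form with coefficient vector `v` is homogeneous of degree `ν`. [folklore] -/
theorem isHomogeneous_poly (v : ↥(Finset.Nat.antidiagonalTuple (m + 1) ν) → ℚ) :
    (Fintype.linearCombination ℚ (fun k' : ↥(Finset.Nat.antidiagonalTuple (m + 1) ν) =>
        (monomial (Finsupp.equivFunOnFinite.symm (k' : Fin (m + 1) → ℕ)) (1 : ℚ) : Rx m)) v).IsHomogeneous ν := by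
  rw [Fintype.linearCombination_apply]
  refine IsHomogeneous.sum _ _ _ fun k _ => ?_
  rw [smul_monomial]
  exact isHomogeneous_monomial _ (degree_expnt k)

/-- A form of degree `ν` is the form of its coefficient vector. [folklore] -/
theorem eq_poly_of_isHomogeneous {g : Rx m} (hg : g.IsHomogeneous ν) :
    g = Fintype.linearCombination ℚ (fun k' : ↥(Finset.Nat.antidiagonalTuple (m + 1) ν) =>
        (monomial (Finsupp.equivFunOnFinite.symm (k' : Fin (m + 1) → ℕ)) (1 : ℚ) : Rx m))
      (fun k => coeff (Finsupp.equivFunOnFinite.symm (k : Fin (m + 1) → ℕ)) g) := by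
  classical
  refine MvPolynomial.ext _ _ fun d => ?_
  by_cases hd : d.degree = ν
  · have hmem : Finsupp.equivFunOnFinite d ∈ Finset.Nat.antidiagonalTuple (m + 1) ν := by
      rw [Finset.Nat.mem_antidiagonalTuple, ← hd, Finsupp.degree_eq_sum]
      simp
    have hk : Finsupp.equivFunOnFinite.symm
        ((⟨Finsupp.equivFunOnFinite d, hmem⟩ : ↥(Finset.Nat.antidiagonalTuple (m + 1) ν)) :
          Fin (m + 1) → ℕ) = d := by simp
    rw [← hk, coeff_poly]
  · rw [coeff_poly_of_ne _ hd, hg.coeff_eq_zero hd]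

/-- Evaluation of the form of `v`: `∑_k v_k x^k`. [folklore] -/
theorem aeval_poly {A : Type*} [CommRing A] [Algebra ℚ A] (x : Fin (m + 1) → A)
    (v : ↥(Finset.Nat.antidiagonalTuple (m + 1) ν) → ℚ) :
    aeval x (Fintype.linearCombination ℚ (fun k' : ↥(Finset.Nat.antidiagonalTuple (m + 1) ν) =>
        (monomial (Finsupp.equivFunOnFinite.symm (k' : Fin (m + 1) → ℕ)) (1 : ℚ) : Rx m)) v) =
      ∑ k : ↥(Finset.Nat.antidiagonalTuple (m + 1) ν), v k • ∏ i, x i ^ (k : Fin (m + 1) → ℕ) i := by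
  rw [Fintype.linearCombination_apply, map_sum]
  refine Finset.sum_congr rfl fun k _ => ?_
  rw [map_smul, aeval_monomial, map_one, one_mul, Finsupp.prod_fintype _ _ (fun i => pow_zero _)]
  simp

/-- The height of the form of `v` is at most the height of `v` (its coefficients are among the
entries of `v`). [cite: NesterenkoPhilippon2001, Ch. 3 Def. 4.2 (p. 38)] -/
theorem height_poly_le (v : ↥(Finset.Nat.antidiagonalTuple (m + 1) ν) → ℚ) :
    height (Fintype.linearCombination ℚ (fun k' : ↥(Finset.Nat.antidiagonalTuple (m + 1) ν) =>
        (monomial (Finsupp.equivFunOnFinite.symm (k' : Fin (m + 1) → ℕ)) (1 : ℚ) : Rx m)) v) ≤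
      Height.logHeight v := by
  classical
  set g := Fintype.linearCombination ℚ (fun k' : ↥(Finset.Nat.antidiagonalTuple (m + 1) ν) =>
        (monomial (Finsupp.equivFunOnFinite.symm (k' : Fin (m + 1) → ℕ)) (1 : ℚ) : Rx m)) v with hg_def
  have hsupp : ∀ γ : g.support, (Finsupp.equivFunOnFinite (γ : Fin (m + 1) →₀ ℕ)) ∈
      Finset.Nat.antidiagonalTuple (m + 1) ν := fun γ => by
    have hdeg : (γ : Fin (m + 1) →₀ ℕ).degree = ν := by
      by_contra h
      exact (mem_support_iff.mp γ.2) (coeff_poly_of_ne v h)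
    rw [Finset.Nat.mem_antidiagonalTuple, ← hdeg, Finsupp.degree_eq_sum]
    simp
  set φ : g.support → ↥(Finset.Nat.antidiagonalTuple (m + 1) ν) :=
    fun γ => ⟨Finsupp.equivFunOnFinite (γ : Fin (m + 1) →₀ ℕ), hsupp γ⟩ with hφ
  have heq : (fun γ : g.support => coeff (γ : Fin (m + 1) →₀ ℕ) g) = v ∘ φ := funext fun γ => by
    have hk : Finsupp.equivFunOnFinite.symm ((φ γ : ↥(Finset.Nat.antidiagonalTuple (m + 1) ν)) :
        Fin (m + 1) → ℕ) = (γ : Fin (m + 1) →₀ ℕ) := by simp [φ]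
    rw [Function.comp_apply, ← coeff_poly v (φ γ), hk]
  unfold height
  rw [heq]
  exact Height.logHeight_comp_le φ v

/-! ## Membership in the ideal of an orbit is vanishing at the generic point -/

/-- For a form `G` of degree `ν ≥ 1` and the dictionary `(K, b̄)` of a homogeneous prime `𝔭` of
rank `1`: `G ∈ 𝔭 ⟺ G(b̄) = 0`. [cite: NesterenkoPhilippon2001, Ch. 3 §5 (p. 42)] -/
theorem mem_iff_aeval_b_eq_zero {𝔭 : Ideal (Rx m)} (h𝔭 : 𝔭.IsPrime) {K : Type} [Field K]
    [NumberField K] {b : Fin (m + 1) → K} (hb0 : b ≠ 0)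
    (hA : ∀ β : Fin (m + 1) → ℂ, β ∈ projZeros 𝔭 ↔
      β ≠ 0 ∧ ∃ (σ : K →+* ℂ) (l : ℂ), β = fun j => l * σ (b j))
    {G : Rx m} (hG : G.IsHomogeneous ν) (hν : 1 ≤ ν) : G ∈ 𝔭 ↔ aeval b G = 0 := by
  obtain ⟨j₀, hj₀⟩ := Function.ne_iff.mp hb0
  have hσb : ∀ σ : K →+* ℂ, (fun j => σ (b j)) ∈ projZeros 𝔭 := fun σ =>
    (hA _).mpr ⟨fun h => hj₀ ((map_eq_zero σ).mp (by simpa using congrFun h j₀)), σ, 1, by simp⟩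
  obtain ⟨σ₀⟩ : Nonempty (K →+* ℂ) := by
    rw [← Fintype.card_pos_iff, NumberField.Embeddings.card]; exact Module.finrank_pos
  constructor
  · intro hG𝔭
    have h := (hσb σ₀).2 G hG𝔭
    rwa [← ringHom_aeval_eq σ₀ b G, map_eq_zero] at h
  · intro h0
    refine PhilipponMain.mem_of_forall_mem_projZeros_aeval_eq_zero h𝔭
      (PhilipponMain.aeval_zero_eq_zero_of_isHomogeneous hG hν) fun β hβ => ?_
    obtain ⟨-, τ, l, rfl⟩ := (hA β).mp hβ
    have e1 : (fun j => l * τ (b j)) = l • (fun j => τ (b j)) := by ext j; simp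
    rw [e1, aeval_smul_of_isHomogeneous G hG l, ← ringHom_aeval_eq τ b G, h0, map_zero, mul_zero]

end SatelliteHeightOrbitForms

set_option maxHeartbeats 400000 in
open SatelliteHeightOrbitForms in
/-- **Registered sub-goal `orbit_small_forms`** (aux for `stub_satelliteHeight`): an absolute Siegel
set_option maxHeartbeats 400000 in
lemma with basis for the ideal of a Galois orbit. For `m, ν ≥ 1` there is `C = C(m, ν) > 0` such
that for every homogeneous prime `𝔭 ⊂ ℚ[x₀, …, x_m]` of rank `1` (`D = deg 𝔭`) the forms of degree
`ν` in `𝔭` are spanned by finitely many forms `G ∈ 𝔭_ν` with `h(G) ≤ C (h(𝔭)/D + 1)`.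
[cite: BombieriVaaler1983, Theorem 9 (p. 28)] -/
theorem orbit_small_forms : ∀ (m ν : ℕ), 1 ≤ m → 1 ≤ ν → ∃ C : ℝ, 0 < C ∧ ∀ 𝔭 : Ideal (Rx m), 𝔭.IsPrime → (letI := MvPolynomial.gradedAlgebra (σ := Fin (m + 1)) (R := ℚ); 𝔭.IsHomogeneous (homogeneousSubmodule (Fin (m + 1)) ℚ)) → IsUnmixedOfRank 𝔭 1 → ∃ s : Finset (Rx m), (∀ G ∈ s, G ∈ 𝔭 ∧ G.IsHomogeneous ν ∧ height G ≤ C * (iheight 𝔭 1 / ideg 𝔭 1 + 1)) ∧ ∀ G ∈ 𝔭, G.IsHomogeneous ν → G ∈ Submodule.span ℚ (s : Set (Rx m)) := by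
  intro m ν hm hν
  classical
  letI := MvPolynomial.gradedAlgebra (σ := Fin (m + 1)) (R := ℚ)
  obtain ⟨c, hc, hZ⟩ := stub_zeroDimDictionary m hm
  -- the index of monomials and the constant
  set N : ℕ := Fintype.card ↥(Finset.Nat.antidiagonalTuple (m + 1) ν) with hN_def
  have hlogN : 0 ≤ Real.log N := Real.log_natCast_nonneg N
  refine ⟨N * ν * (c + 1) + N * Real.log N + 1, by positivity, ?_⟩
  intro 𝔭 h𝔭 hhom hunm
  obtain ⟨K, _, _, b, hb0, hA, -, hB, hC, -, -⟩ := hZ 𝔭 h𝔭 hhom hunm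
  -- abbreviations: monomials, their values at `b̄`, the linear condition
  set mon : ↥(Finset.Nat.antidiagonalTuple (m + 1) ν) → Rx m :=
    fun k' => monomial (Finsupp.equivFunOnFinite.symm (k' : Fin (m + 1) → ℕ)) (1 : ℚ) with hmon
  set cK : ↥(Finset.Nat.antidiagonalTuple (m + 1) ν) → K :=
    fun k => ∏ i, b i ^ (k : Fin (m + 1) → ℕ) i with hcK
  set T : (↥(Finset.Nat.antidiagonalTuple (m + 1) ν) → ℚ) →ₗ[ℚ] K := Fintype.linearCombination ℚ cK
    with hT
  set V : Submodule ℚ (↥(Finset.Nat.antidiagonalTuple (m + 1) ν) → ℚ) := LinearMap.ker T with hV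
  have haevalT : ∀ v, aeval b (Fintype.linearCombination ℚ mon v) = T v := fun v => by
    rw [hmon, aeval_poly, hT, Fintype.linearCombination_apply]
  have hmemV : ∀ v, Fintype.linearCombination ℚ mon v ∈ 𝔭 ↔ v ∈ V := fun v => by
    rw [hV, LinearMap.mem_ker, ← haevalT, hmon]
    exact mem_iff_aeval_b_eq_zero h𝔭 hb0 hA (isHomogeneous_poly v) hν
  -- pivots and the echelon basis over `ℚ`
  obtain ⟨I₀, e, hP, he, hspan⟩ := SatelliteHeightConjugates.exists_echelon V
  -- the values `(b̄^k)_{k ∈ I₀}` are `ℚ`-independent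
  have hcI : LinearIndependent ℚ (fun i : ↥I₀ => cK i) := by
    rw [Fintype.linearIndependent_iff]
    intro g hg i
    set v : ↥(Finset.Nat.antidiagonalTuple (m + 1) ν) → ℚ :=
      fun k => if h : k ∈ I₀ then g ⟨k, h⟩ else 0 with hv
    have hvV : v ∈ V := by
      rw [hV, LinearMap.mem_ker, hT, Fintype.linearCombination_apply, ← hg]
      have h1 : ∑ k, v k • cK k = ∑ k ∈ I₀, v k • cK k := by
        refine (Finset.sum_subset (Finset.subset_univ I₀) fun k _ hk => ?_).symm
        simp [v, hk]
      rw [h1, ← Finset.sum_coe_sort I₀]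
      refine Finset.sum_congr rfl fun k _ => ?_
      simp [v, k.2]
    have hv0 := hP v hvV fun k hk => by simp [v, hk]
    have := congrFun hv0 i
    simpa [v, i.2] using this
  -- the compositum `L` of the conjugate fields
  haveI hfd : ∀ σ : K →+* ℂ, FiniteDimensional ℚ ↥(σ.toRatAlgHom).fieldRange := fun σ =>
    LinearEquiv.finiteDimensional (AlgEquiv.ofInjectiveField σ.toRatAlgHom).toLinearEquiv
  set L : IntermediateField ℚ ℂ := ⨆ σ : K →+* ℂ, (σ.toRatAlgHom).fieldRange with hL_def
  haveI : FiniteDimensional ℚ ↥L := IntermediateField.finiteDimensional_iSup_of_finite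
  haveI : NumberField ↥L := NguyenRoy.NFPres.numberField_of_intermediateField L
  have hmemL : ∀ (σ : K →+* ℂ) (y : K), σ y ∈ L := fun σ y =>
    (le_iSup (fun σ : K →+* ℂ => (σ.toRatAlgHom).fieldRange) σ) ((AlgHom.mem_fieldRange).mpr ⟨y, rfl⟩)
  set f : (K →+* ℂ) → (K →+* ↥L) := fun σ => σ.codRestrict L (hmemL σ) with hf_def
  have hfinL : (0 : ℝ) < Module.finrank ℚ ↥L := by exact_mod_cast Module.finrank_pos
  -- an invertible block of conjugate rows on the pivot columns
  set Y : ↥I₀ → (K →+* ℂ) → ↥L := fun i σ => f σ (cK i) with hY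
  have hYli : LinearIndependent ↥L Y :=
    SatelliteHeightConjugates.linearIndependent_of_lift (algebraMap ↥L ℂ) (fun i : ↥I₀ => cK i) hcI Y
      fun i σ => rfl
  set E' : Matrix (K →+* ℂ) ↥I₀ ↥L := Matrix.of fun σ i => Y i σ with hE'
  have hcol : E'.col = Y := funext fun i => funext fun σ => rfl
  obtain ⟨g, hg⟩ := SatelliteHeightCramer.exists_isUnit_submatrix E' (hcol ▸ hYli)
  set x : ↥I₀ → ↥(Finset.Nat.antidiagonalTuple (m + 1) ν) → ↥L := fun a k => f (g a) (cK k) with hx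
  set emb : ↥I₀ ↪ ↥(Finset.Nat.antidiagonalTuple (m + 1) ν) := Function.Embedding.subtype _ with hemb
  have hMeq : (Matrix.of fun a c' => x a (emb c')) = E'.submatrix g id := Matrix.ext fun _ _ => rfl
  have hMu : IsUnit (Matrix.of fun a c' => x a (emb c')) := by rw [hMeq]; exact hg
  have hMdet : IsUnit (Matrix.of fun a c' => x a (emb c')).det :=
    (Matrix.isUnit_iff_isUnit_det _).mp hMu
  -- kernel vectors of the selected rows supported in `I₀` vanish
  have hKinj : ∀ z : ↥(Finset.Nat.antidiagonalTuple (m + 1) ν) → ↥L,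
      (∀ a, ∑ k, x a k * z k = 0) → (∀ k, k ∉ I₀ → z k = 0) → z = 0 := by
    intro z hz hz0
    have hmv : (Matrix.of fun a c' => x a (emb c')).mulVec (fun c' => z c') = 0 := by
      funext a
      rw [Pi.zero_apply, ← hz a]
      simp only [Matrix.mulVec, dotProduct, Matrix.of_apply]
      rw [← Finset.sum_subset (Finset.subset_univ I₀) (fun k _ hk => by rw [hz0 k hk, mul_zero]),
        ← Finset.sum_coe_sort I₀]
      rfl
    have hz' : (fun c' : ↥I₀ => z c') = 0 :=
      (Matrix.mulVec_injective_iff_isUnit.mpr hMu) (by rw [hmv, Matrix.mulVec_zero])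
    funext k
    by_cases hk : k ∈ I₀
    · exact congrFun hz' ⟨k, hk⟩
    · exact hz0 k hk
  -- heights of the rows
  have hDpos : (0 : ℝ) < ideg 𝔭 1 := by
    have : 0 < Module.finrank ℚ K := Module.finrank_pos
    rw [hB] at this; exact_mod_cast this
  have hKD : (Module.finrank ℚ K : ℝ) = ideg 𝔭 1 := by exact_mod_cast hB
  have hrow : ∀ a, Height.logHeight (x a) / Module.finrank ℚ ↥L ≤ ν * (iheight 𝔭 1 / ideg 𝔭 1 + c) := by
    intro a
    have hxa : x a = fun k : ↥(Finset.Nat.antidiagonalTuple (m + 1) ν) =>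
        ∏ i, (f (g a) (b i)) ^ (k : Fin (m + 1) → ℕ) i := funext fun k => by
      simp [x, cK, map_prod, map_pow]
    have h1 := SatelliteHeightCramer.logHeight_veronese_le ν (fun i => f (g a) (b i))
    have h2 : Height.logHeight (fun i => f (g a) (b i)) / Module.finrank ℚ ↥L =
        Height.logHeight b / Module.finrank ℚ K := NguyenRoy.logHeight_comp_div_finrank (f (g a)) b
    have h3 : Height.logHeight b / Module.finrank ℚ K ≤ iheight 𝔭 1 / ideg 𝔭 1 + c := by
      rw [hKD, div_add' _ _ _ hDpos.ne', div_le_div_iff_of_pos_right hDpos]; exact hC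
    rw [hxa]
    calc Height.logHeight (fun k : ↥(Finset.Nat.antidiagonalTuple (m + 1) ν) =>
          ∏ i, (f (g a) (b i)) ^ (k : Fin (m + 1) → ℕ) i) / Module.finrank ℚ ↥L
        ≤ ν * Height.logHeight (fun i => f (g a) (b i)) / Module.finrank ℚ ↥L :=
          div_le_div_of_nonneg_right h1 hfinL.le
      _ = ν * (Height.logHeight b / Module.finrank ℚ K) := by rw [mul_div_assoc, h2]
      _ ≤ ν * (iheight 𝔭 1 / ideg 𝔭 1 + c) := mul_le_mul_of_nonneg_left h3 (Nat.cast_nonneg _)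
  have hI₀N : (Fintype.card ↥I₀ : ℝ) ≤ N := by
    rw [hN_def, Fintype.card_coe]; exact_mod_cast Finset.card_le_univ I₀
  -- the small spanning forms
  have hsmall : ∀ j, j ∉ I₀ → Height.logHeight (e j) ≤
      (N * ν * (c + 1) + N * Real.log N + 1) * (iheight 𝔭 1 / ideg 𝔭 1 + 1) := by
    intro j hj
    have hj' : j ∉ Set.range emb := fun ⟨a, ha⟩ => hj (ha ▸ a.2)
    obtain ⟨w, hwj, hw0, hwker, hwh⟩ :=
      exists_cramer_vector ↥L ↥(Finset.Nat.antidiagonalTuple (m + 1) ν) ↥I₀ x emb j hj' hMdet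
    set u : ↥(Finset.Nat.antidiagonalTuple (m + 1) ν) → ↥L := fun k => algebraMap ℚ ↥L (e j k) with hu
    have huker : ∀ a, ∑ k, x a k * u k = 0 := fun a => by
      have h1 : ∑ k, x a k * u k = f (g a) (T (e j)) := by
        rw [hT, Fintype.linearCombination_apply, map_sum]
        refine Finset.sum_congr rfl fun k _ => ?_
        simp only [x, u, Algebra.smul_def, map_mul, eq_ratCast]
        rw [mul_comm]
        congr 1
        exact (map_ratCast (f (g a)) (e j k)).symm
      rw [h1, LinearMap.mem_ker.mp (he j hj).1, map_zero]
    have key : (w j) • u = w := by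
      refine (sub_eq_zero.mp (hKinj ((w j) • u - w) (fun a => ?_) (fun k hk => ?_)))
      · simp only [Pi.sub_apply, Pi.smul_apply, smul_eq_mul, mul_sub, Finset.sum_sub_distrib]
        rw [hwker a, sub_zero]
        calc ∑ k, x a k * (w j * u k) = w j * ∑ k, x a k * u k := by
              rw [Finset.mul_sum]; exact Finset.sum_congr rfl fun k _ => by ring
          _ = 0 := by rw [huker a, mul_zero]
      · by_cases hkj : k = j
        · subst hkj
          simp only [Pi.sub_apply, Pi.smul_apply, smul_eq_mul, u, (he k hk).2.1, map_one, mul_one,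
            sub_self]
        · simp only [Pi.sub_apply, Pi.smul_apply, smul_eq_mul, u, (he j hj).2.2 k hk hkj, map_zero,
            mul_zero, hw0 k (fun ⟨a, ha⟩ => hk (ha ▸ a.2)) hkj, sub_self]
    have hhu : Height.logHeight w = Height.logHeight u := by
      rw [← key, Height.logHeight_smul_eq_logHeight u hwj]
    have hue : Height.logHeight u / Module.finrank ℚ ↥L = Height.logHeight (e j) := by
      have h := NguyenRoy.logHeight_comp_div_finrank (algebraMap ℚ ↥L) (e j)
      rw [Module.finrank_self, Nat.cast_one, div_one] at h
      exact h
    have hsum : (∑ a, Height.logHeight (x a)) / Module.finrank ℚ ↥L ≤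
        Fintype.card ↥I₀ * (ν * (iheight 𝔭 1 / ideg 𝔭 1 + c)) := by
      rw [Finset.sum_div]
      calc ∑ a, Height.logHeight (x a) / Module.finrank ℚ ↥L
          ≤ ∑ _a : ↥I₀, ν * (iheight 𝔭 1 / ideg 𝔭 1 + c) := Finset.sum_le_sum fun a _ => hrow a
        _ = Fintype.card ↥I₀ * (ν * (iheight 𝔭 1 / ideg 𝔭 1 + c)) := by
          rw [Finset.sum_const, Finset.card_univ, nsmul_eq_mul]
    have hnn : 0 ≤ iheight 𝔭 1 / ideg 𝔭 1 := div_nonneg (height_nonneg _) hDpos.le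
    have hνR : (1 : ℝ) ≤ ν := by exact_mod_cast hν
    calc Height.logHeight (e j) = Height.logHeight w / Module.finrank ℚ ↥L := by rw [← hue, hhu]
      _ ≤ (∑ a, Height.logHeight (x a) +
            Fintype.card ↥I₀ * Real.log N * Module.finrank ℚ ↥L) / Module.finrank ℚ ↥L :=
          div_le_div_of_nonneg_right hwh hfinL.le
      _ = (∑ a, Height.logHeight (x a)) / Module.finrank ℚ ↥L + Fintype.card ↥I₀ * Real.log N := by
          field_simp
      _ ≤ Fintype.card ↥I₀ * (ν * (iheight 𝔭 1 / ideg 𝔭 1 + c)) + Fintype.card ↥I₀ * Real.log N :=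
          add_le_add hsum le_rfl
      _ ≤ N * (ν * (iheight 𝔭 1 / ideg 𝔭 1 + c)) + N * Real.log N :=
          add_le_add (mul_le_mul_of_nonneg_right hI₀N (by positivity))
            (mul_le_mul_of_nonneg_right hI₀N hlogN)
      _ ≤ (N * ν * (c + 1) + N * Real.log N + 1) * (iheight 𝔭 1 / ideg 𝔭 1 + 1) := by
          have hNν : (0 : ℝ) ≤ (N : ℝ) * ν := by positivity
          have h1 : (0 : ℝ) ≤ (N : ℝ) * ν * (iheight 𝔭 1 / ideg 𝔭 1) * c :=
            mul_nonneg (mul_nonneg hNν hnn) hc.le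
          have h2 : (0 : ℝ) ≤ (N : ℝ) * Real.log N * (iheight 𝔭 1 / ideg 𝔭 1) :=
            mul_nonneg (mul_nonneg (Nat.cast_nonneg N) hlogN) hnn
          have hid : (N * ν * (c + 1) + N * Real.log N + 1) * (iheight 𝔭 1 / ideg 𝔭 1 + 1) -
              (N * (ν * (iheight 𝔭 1 / ideg 𝔭 1 + c)) + N * Real.log N) =
              (N : ℝ) * ν * (iheight 𝔭 1 / ideg 𝔭 1) * c + N * ν +
                N * Real.log N * (iheight 𝔭 1 / ideg 𝔭 1) + (iheight 𝔭 1 / ideg 𝔭 1) + 1 := by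
            ring
          nlinarith [hid, h1, h2, hNν, hnn]
  refine ⟨(I₀ᶜ).image (fun j => Fintype.linearCombination ℚ mon (e j)), ?_, ?_⟩
  · intro G hG
    obtain ⟨j, hj, rfl⟩ := Finset.mem_image.mp hG
    have hj' : j ∉ I₀ := Finset.mem_compl.mp hj
    exact ⟨(hmemV _).mpr (he j hj').1, isHomogeneous_poly (e j),
      (height_poly_le (e j)).trans (hsmall j hj')⟩
  · intro G hG𝔭 hG
    set v : ↥(Finset.Nat.antidiagonalTuple (m + 1) ν) → ℚ :=
      fun k => coeff (Finsupp.equivFunOnFinite.symm (k : Fin (m + 1) → ℕ)) G with hv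
    have hGv : G = Fintype.linearCombination ℚ mon v := eq_poly_of_isHomogeneous hG
    have hvV : v ∈ V := (hmemV v).mp (hGv ▸ hG𝔭)
    rw [hGv, hspan v hvV, map_sum]
    refine Submodule.sum_mem _ fun j hj => ?_
    rw [map_smul]
    exact Submodule.smul_mem _ _ (Submodule.subset_span (Finset.mem_coe.mpr
      (Finset.mem_image.mpr ⟨j, hj, rfl⟩)))

end Summit.Schanuel.Schanuel.Cruxes.ApproximationProperty.OrbitInterpolationDeterminant

end
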